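import Summits.QuantumFields.BalabanUV.T4Continuum.Support.ShellMeasureRootCompositionHistoriesSync

/-!
# `T4Continuum.ShellMeasureSeamDominatedSync` — SM-L6 (MR)_j WIRED IN THE CURRENCY OF THE ENDs OF RECORD: the
# domination socket with SLOT-INDEXED thresholds `θ K s` (any slot family), and the HISTORIES-ROAD plug — END-I OF
# RECORD FOR TERM FAMILIES (`ShellMeasureRootCompositionHistoriesSync.shellWeightBound_histories_sync` ∕ `_age`) with
# its wall binder «(M1) per slot for the `s`-small PARTIAL LAW» REPLACED by {(M1) for a SUPPLIER law, shell domination,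
# the DISPLAYED mass ratio (MR)_j, a level majorant} (kernel bookkeeping; no estimate)
(cell `pub-balaban`, sub-cell `t4`, spine estimate NE7c (node U5b); NE7c ROUND-2 crew `t4-ne7c-formalise-*`, unit
`b2b-balaban-t4-ne7c-formalise-leaf-01` gen 2 — companion of this lineage's row S22 `ShellMeasureSeamDominated`
(p209577: the same socket with LEVEL-indexed thresholds `θ (lvl K s)`, the currency of S7a's END-I); OFFERED (journal;
the owner t4-ne7c-p1 books or refuses); ADDITIVE — imports `ShellMeasureRootCompositionHistoriesSync` (p211878) ONLY;
[folklore]; 0 `def`, 0 `def … : Prop`, 0 sorry, 0 citations)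

HONEST FRAMING.  Finite four-torus programme, rung (B)+1 only — NOT infinite volume, NOT a mass gap, NOT the Clay
problem, NOT summit progress.  NE7c = `T4IndicatorShell.ShellWeightBound` is NOT PRINTED in [Balaban 1983–89] and NOT
PROVED; END-I is the COMPOSITION «NE7c ⇐ the named binders» (trigger c3) and this file re-wires ONE displayed binder
group.  SM-L6 = the small-field-dominance MASS RATIO (MR)_j is an ESTIMATE about Bałaban's effective measures: it is a
BINDER here (`hmass…`), never a `def … : Prop` (trigger c2), asserted by nobody.  Nothing of the audited series is
transcribed or cited.  HONEST DEPENDENCY (cell): continuum YM on T⁴ ⇐ BetaPertH ∧ nine spine estimates (0/9 proved);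
BetaPertH ⇐ (D1) ∧ (D4) ∧ CAP+tail; G-an2-4 gates asym, D1 and NE2/3/4.

WHY THIS FILE (owner RULINGS T-NE7c-6∕-7 and pricing remark N-ne7cp1-g27-1, journal 2026-08-20T11:49Z).  The row
owner named the ENDs OF RECORD of node U5b: END-I ABSTRACT := `ShellMeasureRootCompositionSync.shellWeightBound_of_
slotAC_sync` (thresholds BY SLOT `θ K s`, widths `ρ` and constants `D` BY LEVEL) and END-I FOR TERM FAMILIES of B14
(2.17)–(2.18) TYPE := `ShellMeasureRootCompositionHistoriesSync.shellWeightBound_histories_age` (thresholds by AGE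
`ε (K − lvl K s)`; wall = (M1) per slot FOR THE `s`-SMALL PARTIAL LAWS), and ruled that under the cell's cut (terms =
the histories AFTER step K's branch-dependent operations) a live slot's co-factor depends on its outcome, so the per-
history partial laws WITH (MR)_j «REMAIN OF RECORD», (MR)_j displayed through this lineage's `ShellMeasureSeamDominated`
(level-indexed `M (lvl K s)`).  That socket (p209577 §1) is typed in S7a's currency `θ (lvl K s)`; the histories END's
header (p210501) records (MR)_j «supplier-side … through `T4ShellMeasureFibre.slotAntiConcentration_of_dominated` with a
displayed ratio» IN WORDS.  This file makes both LITERAL in kernel, in the currency of the ENDs of record: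
* §1 `hac_dominated_slot_sync` ∕ `hac_dominated_level_sync` — ANY slot family `μ K t s` on slot spaces `Ω K s`,
  thresholds `θ K s`, widths `ρ (lvl K s)`: a law `μ′ K t s` that DOMINATES `μ K t s` on the threshold shell, carries
  (M1) with slot constant `Dslot K t s`, and whose total mass is at most `M K t s` times that of `μ K t s` (THE DISPLAYED
  RATIO, slot-indexed; the level-indexed `M′ (lvl K s)` of p209577 is the instance `M K t s := M′ (lvl K s)`, §3) ⟹ (M1)
  for `μ K t s` with constant `Dslot·M` (slot form) ∕ with the level constant `D (lvl K s)` under the displayed majorant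
  `Dslot K t s · M K t s ≤ D (lvl K s)` (level form = `…Sync.hac_of_slotConst_sync`'s input, i.e. END-I-sync's `hac`
  VERBATIM).  One call of `T4ShellMeasureFibre.slotAntiConcentration_of_dominated` per slot.
* §2 THE HISTORIES-ROAD PLUG: `hac_partialLaw_dominated` = §1 at `μ K t s :=` the `s`-small partial law
  `partialLaw (T K) (ν K t) (small K) (u K t) (θ K) s` — its conclusion is the wall binder `hacA`∕`hacB` of
  `shellWeightBound_histories_sync` TOKEN FOR TOKEN; **`shellWeightBound_histories_sync_dominated`** (rate form),
  **`shellWeightBound_histories_sync_band_dominated`** (road P2's band head, c6) and the D8 instance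
  **`shellWeightBound_histories_age_dominated`** = the ENDs of record with, per run, `hacX` REPLACED by the supplier data
  {`lamX` (supplier laws per slot), `hlamX` ((M1) for them — at live levels END-II's business, SM-L1…SM-L5), `hSX`
  (shell domination `partialLaw ≤ lam` on the threshold shell), `hmassX` ((MR)_j: `lam univ ≤ M·partialLaw univ`),
  `hDMX` (majorant)}; conclusion LITERALLY `T4IndicatorShell.ShellWeightBound l₀ T A B shA shB Wsh` with the END of
  record's `Wsh`, by ONE application of the END of record.
* §3 NOTHING LANDED IS LOST: p209577 §1's level-indexed binder shapes are §1's instance (an `example`).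
WHAT THIS DOES NOT DO.  No (M1), no mass ratio, no domination is PROVED for any of Bałaban's measures (the supplier
laws, their (M1) and the ratio are DISPLAYED — the wall moved to where the printed mechanism puts it, not lowered); no
window∕count (S9), no rate (U1b), no closeness (U1b∕NE3, DV-6); the alternative cut of N-ne7cp1-g27-1 (co-factor
common ⇒ `M = 1`, S17∕S19's mechanism, `ShellMeasureRootCompositionHistoriesLevelZero.partialLaw_cubes`) is not touched.
NOTHING in the countdown moves; NE7c NOT PROVED; spine PROVED 0/9.
-/

noncomputable section

open MeasureTheory Finset
open scoped ENNReal

namespace Summit.QuantumFields.BalabanUV.T4Continuum.ShellMeasureSeamDominatedSync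

open Literature.MathematicalPhysics.QuantumFieldTheory.Balaban1983to89
open T4IndicatorShell (ShellWeightBound)
open T4ShellMeasure (SlotAntiConcentration)
open T4ShellMeasureLevels (LiveWindow)
open T4ShellMeasureFibre (slotAntiConcentration_of_dominated)
open ShellMeasureRootCompositionSync (hac_of_slotConst_sync)
open ShellMeasureRootCompositionHistories (histWeight histShell partialLaw)
open ShellMeasureRootCompositionHistoriesSync (shellWeightBound_histories_sync shellWeightBound_histories_sync_band)

/-! ## §1 SM-L6 per slot, thresholds BY SLOT (any slot family) -/

section AnyFamily

variable {σ : Type*} {Ω : ℕ → σ → Type*} [∀ K s, MeasurableSpace (Ω K s)] {l₀ : ℝ} {S : ℕ → Finset σ}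
  {lvl : ℕ → σ → ℕ} {μ μ' : ∀ K : ℕ, ℝ → ∀ s : σ, Measure (Ω K s)} {u : ∀ K : ℕ, ℝ → ∀ s : σ, Ω K s → ℝ}
  {θ : ℕ → σ → ℝ} {ρ D : ℕ → ℝ} {Dslot M : ℕ → ℝ → σ → ℝ}

/-- **SM-L6 PER SLOT, THRESHOLDS BY SLOT (slot-constant form).**  For every comparison index `K`, source `|t| ≤ l₀`
and slot `s ∈ S K`: a law `μ′ K t s` DOMINATING `μ K t s` on the threshold shell
`{θ K s·(1 − ρ_{lvl s}) ≤ u < θ K s}` (`hS` — e.g. co-tests dropped, densities `≤`), carrying (M1) at threshold `θ K s`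
with slot constant `Dslot K t s` (`hac'` — the SUPPLIER's (M1)), and with total mass at most `M K t s` times that of
`μ K t s` (`hmass` — SM-L6 (MR)_j, THE DISPLAYED RATIO, slot-indexed) ⟹ (M1) for `μ K t s` with constant
`Dslot K t s · M K t s`.  One call of `T4ShellMeasureFibre.slotAntiConcentration_of_dominated` per slot; CONDITIONAL on
every binder; nothing printed is asserted. [folklore] -/
theorem hac_dominated_slot_sync (hρ : ∀ j, 0 ≤ ρ j) (hDslot0 : ∀ K t, |t| ≤ l₀ → ∀ s ∈ S K, 0 ≤ Dslot K t s)
    (hS : ∀ K t, |t| ≤ l₀ → ∀ s ∈ S K,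
      μ K t s {x | θ K s * (1 - ρ (lvl K s)) ≤ u K t s x ∧ u K t s x < θ K s} ≤
        μ' K t s {x | θ K s * (1 - ρ (lvl K s)) ≤ u K t s x ∧ u K t s x < θ K s})
    (hmass : ∀ K t, |t| ≤ l₀ → ∀ s ∈ S K,
      μ' K t s Set.univ ≤ ENNReal.ofReal (M K t s) * μ K t s Set.univ)
    (hac' : ∀ K t, |t| ≤ l₀ → ∀ s ∈ S K,
      SlotAntiConcentration (μ' K t s) (u K t s) (θ K s) (ρ (lvl K s)) (Dslot K t s)) :
    ∀ K t, |t| ≤ l₀ → ∀ s ∈ S K,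
      SlotAntiConcentration (μ K t s) (u K t s) (θ K s) (ρ (lvl K s)) (Dslot K t s * M K t s) :=
  fun K t ht s hs => slotAntiConcentration_of_dominated (hDslot0 K t ht s hs) (hρ _) (hS K t ht s hs)
    (hac' K t ht s hs) (hmass K t ht s hs)

/-- **SM-L6 PER SLOT, THRESHOLDS BY SLOT, LEVEL-CONSTANT FORM (END-I-sync's `hac` VERBATIM).**  The same PLUS the
displayed level majorant `Dslot K t s · M K t s ≤ D (lvl K s)` ⟹ (M1) per slot at threshold `θ K s`, width
`ρ (lvl K s)`, constant `D (lvl K s)` — the wall binder `hacA`∕`hacB` of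
`ShellMeasureRootCompositionSync.shellWeightBound_of_slotAC_sync` token for token (through `…Sync.hac_of_slotConst_sync`).
[folklore] -/
theorem hac_dominated_level_sync (hρ : ∀ j, 0 ≤ ρ j) (hDslot0 : ∀ K t, |t| ≤ l₀ → ∀ s ∈ S K, 0 ≤ Dslot K t s)
    (hS : ∀ K t, |t| ≤ l₀ → ∀ s ∈ S K,
      μ K t s {x | θ K s * (1 - ρ (lvl K s)) ≤ u K t s x ∧ u K t s x < θ K s} ≤
        μ' K t s {x | θ K s * (1 - ρ (lvl K s)) ≤ u K t s x ∧ u K t s x < θ K s})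
    (hmass : ∀ K t, |t| ≤ l₀ → ∀ s ∈ S K,
      μ' K t s Set.univ ≤ ENNReal.ofReal (M K t s) * μ K t s Set.univ)
    (hDM : ∀ K t, |t| ≤ l₀ → ∀ s ∈ S K, Dslot K t s * M K t s ≤ D (lvl K s))
    (hac' : ∀ K t, |t| ≤ l₀ → ∀ s ∈ S K,
      SlotAntiConcentration (μ' K t s) (u K t s) (θ K s) (ρ (lvl K s)) (Dslot K t s)) :
    ∀ K t, |t| ≤ l₀ → ∀ s ∈ S K,
      SlotAntiConcentration (μ K t s) (u K t s) (θ K s) (ρ (lvl K s)) (D (lvl K s)) :=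
  hac_of_slotConst_sync (Dslot := fun K t s => Dslot K t s * M K t s) hρ hDM
    (hac_dominated_slot_sync hρ hDslot0 hS hmass hac')

end AnyFamily

/-! ## §2 The histories road: the END of record's wall binder from supplier laws + (MR)_j; END-I fired -/

section Histories

variable {Ω : ℕ → Type*} [∀ K, MeasurableSpace (Ω K)] {σ ι : Type*} [DecidableEq σ] {T : ℕ → Finset ι}
  {C : ℕ → Finset σ} {small : ℕ → ι → Finset σ} {lvl : ℕ → σ → ℕ} {l₀ : ℝ} {θ : ℕ → σ → ℝ} {ρ : ℕ → ℝ}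

/-- **THE HISTORIES END's WALL BINDER FROM SUPPLIER LAWS + (MR)_j.**  For ONE run with history weights `ν K t τ`,
tested variables `u K t s`, thresholds `θ K s`: supplier laws `lam K t s` on `Ω K` DOMINATING the `s`-small partial law
on the threshold shell (`hS`), carrying (M1) with slot constants (`hlam`), with the DISPLAYED mass ratio
`lam univ ≤ M K t s · partialLaw univ` (`hmass`, SM-L6 (MR)_j) and the majorant `Dslot·M ≤ D (lvl K s)` (`hDM`) ⟹ the
binder `hacA`∕`hacB` of `ShellMeasureRootCompositionHistoriesSync.shellWeightBound_histories_sync` TOKEN FOR TOKEN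
(§1 at `μ K t s :=` the partial law).  CONDITIONAL; nothing printed asserted. [folklore] -/
theorem hac_partialLaw_dominated {ν : ∀ K : ℕ, ℝ → ι → Measure (Ω K)} {u : ∀ K : ℕ, ℝ → σ → Ω K → ℝ} {D : ℕ → ℝ}
    {lam : ∀ K : ℕ, ℝ → σ → Measure (Ω K)} {Dslot M : ℕ → ℝ → σ → ℝ}
    (hρ : ∀ j, 0 ≤ ρ j) (hDslot0 : ∀ K t, |t| ≤ l₀ → ∀ s ∈ C K, 0 ≤ Dslot K t s)
    (hS : ∀ K t, |t| ≤ l₀ → ∀ s ∈ C K,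
      partialLaw (T K) (ν K t) (small K) (u K t) (θ K) s
          {x | θ K s * (1 - ρ (lvl K s)) ≤ u K t s x ∧ u K t s x < θ K s} ≤
        lam K t s {x | θ K s * (1 - ρ (lvl K s)) ≤ u K t s x ∧ u K t s x < θ K s})
    (hmass : ∀ K t, |t| ≤ l₀ → ∀ s ∈ C K,
      lam K t s Set.univ ≤ ENNReal.ofReal (M K t s) * partialLaw (T K) (ν K t) (small K) (u K t) (θ K) s Set.univ)
    (hDM : ∀ K t, |t| ≤ l₀ → ∀ s ∈ C K, Dslot K t s * M K t s ≤ D (lvl K s))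
    (hlam : ∀ K t, |t| ≤ l₀ → ∀ s ∈ C K,
      SlotAntiConcentration (lam K t s) (u K t s) (θ K s) (ρ (lvl K s)) (Dslot K t s)) :
    ∀ K t, |t| ≤ l₀ → ∀ s ∈ C K,
      SlotAntiConcentration (partialLaw (T K) (ν K t) (small K) (u K t) (θ K) s) (u K t s)
        (θ K s) (ρ (lvl K s)) (D (lvl K s)) :=
  hac_dominated_level_sync (Ω := fun K _ => Ω K)
    (μ := fun K t s => partialLaw (T K) (ν K t) (small K) (u K t) (θ K) s) (μ' := fun K t s => lam K t s)
    (u := fun K t s => u K t s) hρ hDslot0 hS hmass hDM hlam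

variable {νA νB : ∀ K : ℕ, ℝ → ι → Measure (Ω K)} [∀ K t τ, IsFiniteMeasure (νA K t τ)]
  [∀ K t τ, IsFiniteMeasure (νB K t τ)] {uA uB : ∀ K : ℕ, ℝ → σ → Ω K → ℝ} {DA DB : ℕ → ℝ} {N₁ : ℕ}
  {νbar Dbar c₁ ϑ : ℝ} {m : ℕ → ℝ}
  {lamA lamB : ∀ K : ℕ, ℝ → σ → Measure (Ω K)} {DslotA DslotB MA MB : ℕ → ℝ → σ → ℝ}

/-- **END-I OF RECORD FOR TERM FAMILIES, THRESHOLDS BY SLOT, WITH SM-L6 (MR)_j DISPLAYED AGAINST SUPPLIER LAWS.**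
`ShellMeasureRootCompositionHistoriesSync.shellWeightBound_histories_sync` with, per run X ∈ {A, B}, the wall binder
`hacX` ((M1) per slot for the `s`-small partial law) REPLACED by: supplier laws `lamX K t s`, their (M1) `hlamX` with
slot constants `DslotX K t s` (at live levels: END-II's business, SM-L1…SM-L5 — displayed), shell domination `hSX`,
THE MASS RATIO `hmassX` (SM-L6 (MR)_j — displayed), the majorant `hDMX : DslotX·MX ≤ DX (lvl K s)`.  Unchanged and
displayed: measurability, `small ⊆ C`, a.e. closeness (node U1b type, DV-6), signs, `LiveWindow` (SM-L7 + count, S9),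
`D ≤ D̄`, the rate `ρ_j ≤ c₁ϑ^j` (SM-L8, node U1b BY NAME, c4).  CONCLUSION: LITERALLY that of the END of record —
`T4IndicatorShell.ShellWeightBound l₀ T A B shA shB Wsh`, history weights∕shell parts at thresholds `θ K`, END-I's
`Wsh K = Σ_{s∈C K} D^A_{lvl s}ρ_{lvl s} + Σ D^B_{lvl s}ρ_{lvl s}`.  ONE application of the END of record; CONDITIONAL on
every binder; nothing printed asserted; NOT NE7c. [folklore] -/
theorem shellWeightBound_histories_sync_dominated (huA : ∀ K t s, Measurable (uA K t s))
    (huB : ∀ K t s, Measurable (uB K t s)) (hsmall : ∀ K, ∀ τ ∈ T K, small K τ ⊆ C K)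
    (hcloseA : ∀ K t, |t| ≤ l₀ → ∀ τ ∈ T K, ∀ s ∈ small K τ,
      ∀ᵐ ω ∂(νA K t τ), |uA K t s ω - uB K t s ω| ≤ ρ (lvl K s) * θ K s)
    (hcloseB : ∀ K t, |t| ≤ l₀ → ∀ τ ∈ T K, ∀ s ∈ small K τ,
      ∀ᵐ ω ∂(νB K t τ), |uB K t s ω - uA K t s ω| ≤ ρ (lvl K s) * θ K s)
    (hDA0 : ∀ j, 0 ≤ DA j) (hDB0 : ∀ j, 0 ≤ DB j) (hρ0 : ∀ j, 0 ≤ ρ j)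
    -- run A: supplier laws, their (M1), shell domination, THE MASS RATIO (MR)_j, majorant
    (hDslotA0 : ∀ K t, |t| ≤ l₀ → ∀ s ∈ C K, 0 ≤ DslotA K t s)
    (hlamA : ∀ K t, |t| ≤ l₀ → ∀ s ∈ C K,
      SlotAntiConcentration (lamA K t s) (uA K t s) (θ K s) (ρ (lvl K s)) (DslotA K t s))
    (hSA : ∀ K t, |t| ≤ l₀ → ∀ s ∈ C K,
      partialLaw (T K) (νA K t) (small K) (uA K t) (θ K) s
          {x | θ K s * (1 - ρ (lvl K s)) ≤ uA K t s x ∧ uA K t s x < θ K s} ≤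
        lamA K t s {x | θ K s * (1 - ρ (lvl K s)) ≤ uA K t s x ∧ uA K t s x < θ K s})
    (hmassA : ∀ K t, |t| ≤ l₀ → ∀ s ∈ C K,
      lamA K t s Set.univ ≤
        ENNReal.ofReal (MA K t s) * partialLaw (T K) (νA K t) (small K) (uA K t) (θ K) s Set.univ)
    (hDMA : ∀ K t, |t| ≤ l₀ → ∀ s ∈ C K, DslotA K t s * MA K t s ≤ DA (lvl K s))
    -- run B: the same
    (hDslotB0 : ∀ K t, |t| ≤ l₀ → ∀ s ∈ C K, 0 ≤ DslotB K t s)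
    (hlamB : ∀ K t, |t| ≤ l₀ → ∀ s ∈ C K,
      SlotAntiConcentration (lamB K t s) (uB K t s) (θ K s) (ρ (lvl K s)) (DslotB K t s))
    (hSB : ∀ K t, |t| ≤ l₀ → ∀ s ∈ C K,
      partialLaw (T K) (νB K t) (small K) (uB K t) (θ K) s
          {x | θ K s * (1 - ρ (lvl K s)) ≤ uB K t s x ∧ uB K t s x < θ K s} ≤
        lamB K t s {x | θ K s * (1 - ρ (lvl K s)) ≤ uB K t s x ∧ uB K t s x < θ K s})
    (hmassB : ∀ K t, |t| ≤ l₀ → ∀ s ∈ C K,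
      lamB K t s Set.univ ≤
        ENNReal.ofReal (MB K t s) * partialLaw (T K) (νB K t) (small K) (uB K t) (θ K) s Set.univ)
    (hDMB : ∀ K t, |t| ≤ l₀ → ∀ s ∈ C K, DslotB K t s * MB K t s ≤ DB (lvl K s))
    -- window, rate
    (hw : LiveWindow C lvl N₁ νbar) (hϑ0 : 0 < ϑ) (hϑ1 : ϑ < 1)
    (hDA : ∀ j, DA j ≤ Dbar) (hDB : ∀ j, DB j ≤ Dbar) (hrate : ∀ j, ρ j ≤ c₁ * ϑ ^ j) :
    ShellWeightBound l₀ T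
      (fun K t τ => histWeight (νA K t τ) (small K τ) (uA K t) (θ K))
      (fun K t τ => histWeight (νB K t τ) (small K τ) (uB K t) (θ K))
      (fun K t τ => histShell (νA K t τ) (small K τ) (uA K t) (uB K t) (θ K))
      (fun K t τ => histShell (νB K t τ) (small K τ) (uB K t) (uA K t) (θ K))
      (fun K => ∑ s ∈ C K, DA (lvl K s) * ρ (lvl K s) + ∑ s ∈ C K, DB (lvl K s) * ρ (lvl K s)) :=
  shellWeightBound_histories_sync huA huB hsmall hcloseA hcloseB hDA0 hDB0 hρ0
    (hac_partialLaw_dominated hρ0 hDslotA0 hSA hmassA hDMA hlamA)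
    (hac_partialLaw_dominated hρ0 hDslotB0 hSB hmassB hDMB hlamB) hw hϑ0 hϑ1 hDA hDB hrate

/-- **END-I, BAND FORM (road P2's head, c6), THRESHOLDS BY SLOT, WITH SM-L6 (MR)_j DISPLAYED.**  The same replacement
in `ShellMeasureRootCompositionHistoriesSync.shellWeightBound_histories_sync_band` (`Summable ρ` + age-resolved live-slot
counts instead of the geometric rate).  CONCLUSION: LITERALLY that END's. [folklore] -/
theorem shellWeightBound_histories_sync_band_dominated (huA : ∀ K t s, Measurable (uA K t s))
    (huB : ∀ K t s, Measurable (uB K t s)) (hsmall : ∀ K, ∀ τ ∈ T K, small K τ ⊆ C K)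
    (hcloseA : ∀ K t, |t| ≤ l₀ → ∀ τ ∈ T K, ∀ s ∈ small K τ,
      ∀ᵐ ω ∂(νA K t τ), |uA K t s ω - uB K t s ω| ≤ ρ (lvl K s) * θ K s)
    (hcloseB : ∀ K t, |t| ≤ l₀ → ∀ τ ∈ T K, ∀ s ∈ small K τ,
      ∀ᵐ ω ∂(νB K t τ), |uB K t s ω - uA K t s ω| ≤ ρ (lvl K s) * θ K s)
    (hDA0 : ∀ j, 0 ≤ DA j) (hDB0 : ∀ j, 0 ≤ DB j) (hρ0 : ∀ j, 0 ≤ ρ j)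
    (hDslotA0 : ∀ K t, |t| ≤ l₀ → ∀ s ∈ C K, 0 ≤ DslotA K t s)
    (hlamA : ∀ K t, |t| ≤ l₀ → ∀ s ∈ C K,
      SlotAntiConcentration (lamA K t s) (uA K t s) (θ K s) (ρ (lvl K s)) (DslotA K t s))
    (hSA : ∀ K t, |t| ≤ l₀ → ∀ s ∈ C K,
      partialLaw (T K) (νA K t) (small K) (uA K t) (θ K) s
          {x | θ K s * (1 - ρ (lvl K s)) ≤ uA K t s x ∧ uA K t s x < θ K s} ≤
        lamA K t s {x | θ K s * (1 - ρ (lvl K s)) ≤ uA K t s x ∧ uA K t s x < θ K s})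
    (hmassA : ∀ K t, |t| ≤ l₀ → ∀ s ∈ C K,
      lamA K t s Set.univ ≤
        ENNReal.ofReal (MA K t s) * partialLaw (T K) (νA K t) (small K) (uA K t) (θ K) s Set.univ)
    (hDMA : ∀ K t, |t| ≤ l₀ → ∀ s ∈ C K, DslotA K t s * MA K t s ≤ DA (lvl K s))
    (hDslotB0 : ∀ K t, |t| ≤ l₀ → ∀ s ∈ C K, 0 ≤ DslotB K t s)
    (hlamB : ∀ K t, |t| ≤ l₀ → ∀ s ∈ C K,
      SlotAntiConcentration (lamB K t s) (uB K t s) (θ K s) (ρ (lvl K s)) (DslotB K t s))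
    (hSB : ∀ K t, |t| ≤ l₀ → ∀ s ∈ C K,
      partialLaw (T K) (νB K t) (small K) (uB K t) (θ K) s
          {x | θ K s * (1 - ρ (lvl K s)) ≤ uB K t s x ∧ uB K t s x < θ K s} ≤
        lamB K t s {x | θ K s * (1 - ρ (lvl K s)) ≤ uB K t s x ∧ uB K t s x < θ K s})
    (hmassB : ∀ K t, |t| ≤ l₀ → ∀ s ∈ C K,
      lamB K t s Set.univ ≤
        ENNReal.ofReal (MB K t s) * partialLaw (T K) (νB K t) (small K) (uB K t) (θ K) s Set.univ)
    (hDMB : ∀ K t, |t| ≤ l₀ → ∀ s ∈ C K, DslotB K t s * MB K t s ≤ DB (lvl K s))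
    (hw : LiveWindow C lvl N₁ νbar) (hDA : ∀ j, DA j ≤ Dbar) (hDB : ∀ j, DB j ≤ Dbar)
    (hm : ∀ K, ∀ a ≤ N₁, (((C K).filter fun s => K - lvl K s = a).card : ℝ) ≤ m a) (hρ : Summable ρ) :
    ShellWeightBound l₀ T
      (fun K t τ => histWeight (νA K t τ) (small K τ) (uA K t) (θ K))
      (fun K t τ => histWeight (νB K t τ) (small K τ) (uB K t) (θ K))
      (fun K t τ => histShell (νA K t τ) (small K τ) (uA K t) (uB K t) (θ K))
      (fun K t τ => histShell (νB K t τ) (small K τ) (uB K t) (uA K t) (θ K))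
      (fun K => ∑ s ∈ C K, DA (lvl K s) * ρ (lvl K s) + ∑ s ∈ C K, DB (lvl K s) * ρ (lvl K s)) :=
  shellWeightBound_histories_sync_band huA huB hsmall hcloseA hcloseB hDA0 hDB0 hρ0
    (hac_partialLaw_dominated hρ0 hDslotA0 hSA hmassA hDMA hlamA)
    (hac_partialLaw_dominated hρ0 hDslotB0 hSB hmassB hDMB hlamB) hw hDA hDB hm hρ

/-- **THE D8 INSTANCE — END-I OF RECORD FOR TERM FAMILIES (`…HistoriesSync.shellWeightBound_histories_age`, owner
RULING T-NE7c-7) WITH SM-L6 (MR)_j DISPLAYED AGAINST SUPPLIER LAWS**: thresholds by AGE `ε (K − lvl K s)` for one profile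
`ε : ℕ → ℝ` (nothing about `ε` assumed); per run the supplier data of `shellWeightBound_histories_sync_dominated` at
`θ K s := ε (K − lvl K s)`.  CONCLUSION: LITERALLY that of `shellWeightBound_histories_age`.  This is the kernel form of
the owner's sentence «S24's per-history partial laws with (MR)_j REMAIN OF RECORD» (N-ne7cp1-g27-1).  CONDITIONAL on
every binder; nothing printed asserted; NOT NE7c. [folklore] -/
theorem shellWeightBound_histories_age_dominated {ε : ℕ → ℝ} (huA : ∀ K t s, Measurable (uA K t s))
    (huB : ∀ K t s, Measurable (uB K t s)) (hsmall : ∀ K, ∀ τ ∈ T K, small K τ ⊆ C K)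
    (hcloseA : ∀ K t, |t| ≤ l₀ → ∀ τ ∈ T K, ∀ s ∈ small K τ,
      ∀ᵐ ω ∂(νA K t τ), |uA K t s ω - uB K t s ω| ≤ ρ (lvl K s) * ε (K - lvl K s))
    (hcloseB : ∀ K t, |t| ≤ l₀ → ∀ τ ∈ T K, ∀ s ∈ small K τ,
      ∀ᵐ ω ∂(νB K t τ), |uB K t s ω - uA K t s ω| ≤ ρ (lvl K s) * ε (K - lvl K s))
    (hDA0 : ∀ j, 0 ≤ DA j) (hDB0 : ∀ j, 0 ≤ DB j) (hρ0 : ∀ j, 0 ≤ ρ j)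
    (hDslotA0 : ∀ K t, |t| ≤ l₀ → ∀ s ∈ C K, 0 ≤ DslotA K t s)
    (hlamA : ∀ K t, |t| ≤ l₀ → ∀ s ∈ C K,
      SlotAntiConcentration (lamA K t s) (uA K t s) (ε (K - lvl K s)) (ρ (lvl K s)) (DslotA K t s))
    (hSA : ∀ K t, |t| ≤ l₀ → ∀ s ∈ C K,
      partialLaw (T K) (νA K t) (small K) (uA K t) (fun s => ε (K - lvl K s)) s
          {x | ε (K - lvl K s) * (1 - ρ (lvl K s)) ≤ uA K t s x ∧ uA K t s x < ε (K - lvl K s)} ≤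
        lamA K t s {x | ε (K - lvl K s) * (1 - ρ (lvl K s)) ≤ uA K t s x ∧ uA K t s x < ε (K - lvl K s)})
    (hmassA : ∀ K t, |t| ≤ l₀ → ∀ s ∈ C K,
      lamA K t s Set.univ ≤ ENNReal.ofReal (MA K t s) *
        partialLaw (T K) (νA K t) (small K) (uA K t) (fun s => ε (K - lvl K s)) s Set.univ)
    (hDMA : ∀ K t, |t| ≤ l₀ → ∀ s ∈ C K, DslotA K t s * MA K t s ≤ DA (lvl K s))
    (hDslotB0 : ∀ K t, |t| ≤ l₀ → ∀ s ∈ C K, 0 ≤ DslotB K t s)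
    (hlamB : ∀ K t, |t| ≤ l₀ → ∀ s ∈ C K,
      SlotAntiConcentration (lamB K t s) (uB K t s) (ε (K - lvl K s)) (ρ (lvl K s)) (DslotB K t s))
    (hSB : ∀ K t, |t| ≤ l₀ → ∀ s ∈ C K,
      partialLaw (T K) (νB K t) (small K) (uB K t) (fun s => ε (K - lvl K s)) s
          {x | ε (K - lvl K s) * (1 - ρ (lvl K s)) ≤ uB K t s x ∧ uB K t s x < ε (K - lvl K s)} ≤
        lamB K t s {x | ε (K - lvl K s) * (1 - ρ (lvl K s)) ≤ uB K t s x ∧ uB K t s x < ε (K - lvl K s)})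
    (hmassB : ∀ K t, |t| ≤ l₀ → ∀ s ∈ C K,
      lamB K t s Set.univ ≤ ENNReal.ofReal (MB K t s) *
        partialLaw (T K) (νB K t) (small K) (uB K t) (fun s => ε (K - lvl K s)) s Set.univ)
    (hDMB : ∀ K t, |t| ≤ l₀ → ∀ s ∈ C K, DslotB K t s * MB K t s ≤ DB (lvl K s))
    (hw : LiveWindow C lvl N₁ νbar) (hϑ0 : 0 < ϑ) (hϑ1 : ϑ < 1)
    (hDA : ∀ j, DA j ≤ Dbar) (hDB : ∀ j, DB j ≤ Dbar) (hrate : ∀ j, ρ j ≤ c₁ * ϑ ^ j) :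
    ShellWeightBound l₀ T
      (fun K t τ => histWeight (νA K t τ) (small K τ) (uA K t) (fun s => ε (K - lvl K s)))
      (fun K t τ => histWeight (νB K t τ) (small K τ) (uB K t) (fun s => ε (K - lvl K s)))
      (fun K t τ => histShell (νA K t τ) (small K τ) (uA K t) (uB K t) (fun s => ε (K - lvl K s)))
      (fun K t τ => histShell (νB K t τ) (small K τ) (uB K t) (uA K t) (fun s => ε (K - lvl K s)))
      (fun K => ∑ s ∈ C K, DA (lvl K s) * ρ (lvl K s) + ∑ s ∈ C K, DB (lvl K s) * ρ (lvl K s)) :=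
  shellWeightBound_histories_sync_dominated (θ := fun K s => ε (K - lvl K s)) huA huB hsmall hcloseA hcloseB hDA0
    hDB0 hρ0 hDslotA0 hlamA hSA hmassA hDMA hDslotB0 hlamB hSB hmassB hDMB hw hϑ0 hϑ1 hDA hDB hrate

end Histories

/-! ## §3 Nothing landed is lost: the level-indexed socket of p209577 is §1's instance -/

section NothingLost

variable {σ : Type*} {Ω : ℕ → σ → Type*} [∀ K s, MeasurableSpace (Ω K s)] {l₀ : ℝ} {S : ℕ → Finset σ}
  {lvl : ℕ → σ → ℕ} {μ μ' : ∀ K : ℕ, ℝ → ∀ s : σ, Measure (Ω K s)} {u : ∀ K : ℕ, ℝ → ∀ s : σ, Ω K s → ℝ}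
  {θ' ρ : ℕ → ℝ} {Dslot : ℕ → ℝ → σ → ℝ} {M' : ℕ → ℝ}

/-- NOTHING LANDED IS LOST: `ShellMeasureSeamDominated.hac_dominated_slot` (p209577 §1: thresholds `θ′ (lvl K s)`,
level-indexed ratio `M′ (lvl K s)`) — same binders, same conclusion — IS `hac_dominated_slot_sync` at
`θ K s := θ′ (lvl K s)`, `M K t s := M′ (lvl K s)`. [folklore] -/
example (hρ : ∀ j, 0 ≤ ρ j) (hDslot0 : ∀ K t, |t| ≤ l₀ → ∀ s ∈ S K, 0 ≤ Dslot K t s)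
    (hS : ∀ K t, |t| ≤ l₀ → ∀ s ∈ S K,
      μ K t s {x | θ' (lvl K s) * (1 - ρ (lvl K s)) ≤ u K t s x ∧ u K t s x < θ' (lvl K s)} ≤
        μ' K t s {x | θ' (lvl K s) * (1 - ρ (lvl K s)) ≤ u K t s x ∧ u K t s x < θ' (lvl K s)})
    (hmass : ∀ K t, |t| ≤ l₀ → ∀ s ∈ S K,
      μ' K t s Set.univ ≤ ENNReal.ofReal (M' (lvl K s)) * μ K t s Set.univ)
    (hac' : ∀ K t, |t| ≤ l₀ → ∀ s ∈ S K,
      SlotAntiConcentration (μ' K t s) (u K t s) (θ' (lvl K s)) (ρ (lvl K s)) (Dslot K t s)) :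
    ∀ K t, |t| ≤ l₀ → ∀ s ∈ S K,
      SlotAntiConcentration (μ K t s) (u K t s) (θ' (lvl K s)) (ρ (lvl K s)) (Dslot K t s * M' (lvl K s)) :=
  hac_dominated_slot_sync (θ := fun K s => θ' (lvl K s)) (M := fun K _ s => M' (lvl K s)) hρ hDslot0 hS hmass hac'

end NothingLost

end Summit.QuantumFields.BalabanUV.T4Continuum.ShellMeasureSeamDominatedSync

end
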